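import Literature.Analysis.UnboundedOperators.HeatKernel
import Mathlib.Analysis.SpecialFunctions.Gamma.Basic
import HarnessLib

/-!
# M. Riesz' balayage onto a plane: the two certificate integrals (stub C2)

Stub `stub_rieszBalayage` (C2) of line `single-layer-linear-regression` for the crux
`GaussianLimitNotScreened` (stmt-CriticalPhenomena-13886).  For `1/2 ≤ Δ < 1` and the Riesz
kernel `|v - w|^{-2Δ}` on `ℝ² = EuclideanSpace ℝ (Fin 2)`:

* `∫ (1+|w|²)^{Δ-2} |v-w|^{-2Δ} dw = (π/(1-Δ)) (1+|v|²)^{-Δ}` for every `v` — the density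
  `ψ_Δ = ((1-Δ)/π)(1+|·|²)^{Δ-2}` is M. Riesz' balayage of `δ_{e₀}` onto the plane
  `{x₀ = 0}` of `ℝ³` for the kernel `|x|^{-2Δ}` (the Poisson kernel at `Δ = 1/2`);
* its mass against `p₁ = (1+|·|²)^{-Δ}`: `∫ (1+|v|²)^{Δ-2} (1+|v|²)^{-Δ} dv = π`.

Proof: Gaussian subordination.  Both factors are Laplace transforms of powers
(`r^{-a} Γ(a) = ∫₀^∞ t^{a-1} e^{-rt} dt`), the `w`-integral of a product of two Gaussians
is a Gaussian (`Literature.Analysis.UnboundedOperators`, convolution of heat kernels), and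
the remaining one-dimensional integrals are again Euler integrals; the constant comes out as
`π Γ(Δ) Γ(1-Δ) / (Γ(Δ) Γ(2-Δ)) = π/(1-Δ)`.  Everything is non-negative, so the whole
computation is done with lower Lebesgue integrals and Tonelli, and converted to Bochner
integrals at the end (no integrability side condition is ever needed).
-/

namespace Summit.CriticalPhenomena.Ising3DConformalLimit.Cruxes.GaussianLimitNotScreened.SingleLayerLinearRegression

open MeasureTheory Filter Topology Real Set Literature.Analysis.UnboundedOperators
open scoped ENNReal

/-- Euler's integral `∫₀^∞ t^{a-1} e^{-rt} dt = r^{-a} Γ(a)` (`0 < a`, `0 < r`) as a lower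
Lebesgue integral. [folklore] -/
theorem rieszBalayage_lintegral_rpow_mul_exp {a r : ℝ} (ha : 0 < a) (hr : 0 < r) :
    ∫⁻ t in Ioi (0:ℝ), ENNReal.ofReal (t ^ (a - 1) * rexp (-(r * t))) =
      ENNReal.ofReal ((1 / r) ^ a * Real.Gamma a) := by
  have hpos : 0 < (1 / r) ^ a * Real.Gamma a := by positivity
  have hint : IntegrableOn (fun t : ℝ => t ^ (a - 1) * rexp (-(r * t))) (Ioi 0) := by
    refine Integrable.of_integral_ne_zero ?_
    rw [Real.integral_rpow_mul_exp_neg_mul_Ioi ha hr]; exact hpos.ne'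
  rw [← Real.integral_rpow_mul_exp_neg_mul_Ioi ha hr, ofReal_integral_eq_lintegral_ofReal hint]
  exact (ae_restrict_mem measurableSet_Ioi).mono fun t (ht : 0 < t) => by positivity

/-- `∫₀^∞ e^{-rt} dt = 1/r` (`0 < r`) as a lower Lebesgue integral. [folklore] -/
theorem rieszBalayage_lintegral_exp {r : ℝ} (hr : 0 < r) :
    ∫⁻ t in Ioi (0:ℝ), ENNReal.ofReal (rexp (-(r * t))) = ENNReal.ofReal (1 / r) := by
  have key := rieszBalayage_lintegral_rpow_mul_exp one_pos hr
  rw [Real.rpow_one, Real.Gamma_one, mul_one] at key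
  rw [← key]
  refine setLIntegral_congr_fun measurableSet_Ioi (fun t _ => ?_)
  simp

/-- Convolution of two centred Gaussians on `ℝ²`:
`∫ e^{-s|w|²} e^{-t|v-w|²} dw = (π/(s+t)) e^{-(st/(s+t))|v|²}`, as a lower Lebesgue integral
(the tree's `integral_rexp_neg_mul_sq_norm_mul_rexp_neg_mul_sq_norm_sub` in dimension `2`).
[folklore] -/
theorem rieszBalayage_lintegral_gauss_conv {s t : ℝ} (hs : 0 < s) (ht : 0 < t)
    (v : EuclideanSpace ℝ (Fin 2)) :
    ∫⁻ w : EuclideanSpace ℝ (Fin 2),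
        ENNReal.ofReal (rexp (-s * ‖w‖ ^ 2) * rexp (-t * ‖v - w‖ ^ 2)) =
      ENNReal.ofReal (π / (s + t) * rexp (-(s * t / (s + t)) * ‖v‖ ^ 2)) := by
  have key := integral_rexp_neg_mul_sq_norm_mul_rexp_neg_mul_sq_norm_sub hs ht v
  rw [finrank_euclideanSpace_fin, show ((2 : ℕ) : ℝ) / 2 = 1 by norm_num, Real.rpow_one] at key
  have hpos : 0 < π / (s + t) * rexp (-(s * t / (s + t)) * ‖v‖ ^ 2) := by positivity
  have hint : Integrable (fun w : EuclideanSpace ℝ (Fin 2) =>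
      rexp (-s * ‖w‖ ^ 2) * rexp (-t * ‖v - w‖ ^ 2)) := by
    refine Integrable.of_integral_ne_zero ?_
    rw [key]; exact hpos.ne'
  rw [← key, ofReal_integral_eq_lintegral_ofReal hint]
  exact Eventually.of_forall fun w => by positivity

/-- The Gaussian integral on `ℝ²`: `∫ e^{-s|w|²} dw = π/s`, as a lower Lebesgue integral.
[folklore] -/
theorem rieszBalayage_lintegral_gauss {s : ℝ} (hs : 0 < s) :
    ∫⁻ w : EuclideanSpace ℝ (Fin 2), ENNReal.ofReal (rexp (-s * ‖w‖ ^ 2)) =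
      ENNReal.ofReal (π / s) := by
  have key := GaussianFourier.integral_rexp_neg_mul_sq_norm (V := EuclideanSpace ℝ (Fin 2)) hs
  rw [finrank_euclideanSpace_fin, show ((2 : ℕ) : ℝ) / 2 = 1 by norm_num, Real.rpow_one] at key
  have hpos : 0 < π / s := by positivity
  have hint : Integrable (fun w : EuclideanSpace ℝ (Fin 2) => rexp (-s * ‖w‖ ^ 2)) := by
    refine Integrable.of_integral_ne_zero ?_
    rw [key]; exact hpos.ne'
  rw [← key, ofReal_integral_eq_lintegral_ofReal hint]
  exact Eventually.of_forall fun w => by positivity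

/-- The Beta-type integral `∫₀^∞ u^{Δ-1}/(1 + A u) du = A^{-Δ} Γ(Δ) Γ(1-Δ)` for
`0 < Δ < 1`, `0 < A`, as a lower Lebesgue integral (write `1/(1+Au) = ∫₀^∞ e^{-r(1+Au)} dr`,
Tonelli, and two Euler integrals; this is where `Δ < 1` enters). [folklore] -/
theorem rieszBalayage_lintegral_beta {Δ A : ℝ} (hΔ0 : 0 < Δ) (hΔ1 : Δ < 1) (hA : 0 < A) :
    ∫⁻ u in Ioi (0:ℝ), ENNReal.ofReal (u ^ (Δ - 1) / (1 + A * u)) =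
      ENNReal.ofReal (A ^ (-Δ) * Real.Gamma Δ * Real.Gamma (1 - Δ)) := by
  have h1 : ∀ u ∈ Ioi (0:ℝ), ENNReal.ofReal (u ^ (Δ - 1) / (1 + A * u)) =
      ∫⁻ r in Ioi (0:ℝ), ENNReal.ofReal (u ^ (Δ - 1) * rexp (-((1 + A * u) * r))) := by
    intro u hu
    have hu : (0:ℝ) < u := hu
    have h0 : 0 ≤ u ^ (Δ - 1) := by positivity
    simp_rw [ENNReal.ofReal_mul h0]
    rw [lintegral_const_mul' _ _ ENNReal.ofReal_ne_top, rieszBalayage_lintegral_exp (by positivity),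
      ← ENNReal.ofReal_mul h0, div_eq_mul_one_div]
  rw [setLIntegral_congr_fun measurableSet_Ioi h1, lintegral_lintegral_swap (by fun_prop)]
  have h3 : ∀ r ∈ Ioi (0:ℝ), ∫⁻ u in Ioi (0:ℝ),
      ENNReal.ofReal (u ^ (Δ - 1) * rexp (-((1 + A * u) * r))) =
        ENNReal.ofReal (A ^ (-Δ) * Real.Gamma Δ) *
          ENNReal.ofReal (r ^ ((1 - Δ) - 1) * rexp (-(1 * r))) := by
    intro r hr
    have hr : (0:ℝ) < r := hr
    have e : ∀ u : ℝ, ENNReal.ofReal (u ^ (Δ - 1) * rexp (-((1 + A * u) * r))) =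
        ENNReal.ofReal (rexp (-(1 * r))) *
          ENNReal.ofReal (u ^ (Δ - 1) * rexp (-((r * A) * u))) := by
      intro u
      rw [← ENNReal.ofReal_mul (by positivity)]
      congr 1
      rw [show -((1 + A * u) * r) = -(1 * r) + -((r * A) * u) by ring, Real.exp_add]; ring
    simp_rw [e]
    rw [lintegral_const_mul' _ _ ENNReal.ofReal_ne_top,
      rieszBalayage_lintegral_rpow_mul_exp hΔ0 (by positivity),
      ← ENNReal.ofReal_mul (by positivity), ← ENNReal.ofReal_mul (by positivity)]
    congr 1
    rw [one_div, Real.inv_rpow (by positivity), Real.mul_rpow hr.le hA.le,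
      show (1 - Δ) - 1 = -Δ by ring, Real.rpow_neg hr.le, Real.rpow_neg hA.le]
    have h₁ : 0 < r ^ Δ := by positivity
    have h₂ : 0 < A ^ Δ := by positivity
    field_simp
  rw [setLIntegral_congr_fun measurableSet_Ioi h3, lintegral_const_mul' _ _ ENNReal.ofReal_ne_top,
    rieszBalayage_lintegral_rpow_mul_exp (by linarith) one_pos,
    ← ENNReal.ofReal_mul (by positivity)]
  congr 1
  rw [div_one, Real.one_rpow, one_mul]

/-- Gaussian subordination of the kernel: for `w ≠ v` and `0 < Δ < 2`,
`(1+|w|²)^{Δ-2} |v-w|^{-2Δ} =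
  (Γ(2-Δ)Γ(Δ))⁻¹ ∫₀^∞∫₀^∞ s u^{Δ-1} e^{-s} e^{-s|w|²} e^{-su|v-w|²} du ds`
(two Euler integrals, the second with rate `s|v-w|²`), in `ℝ≥0∞`. [folklore] -/
theorem rieszBalayage_kernel_eq_lintegral {Δ : ℝ} (hΔ0 : 0 < Δ) (hΔ2 : Δ < 2)
    (v w : EuclideanSpace ℝ (Fin 2)) (hw : w ≠ v) :
    ENNReal.ofReal ((1 + ‖w‖ ^ 2) ^ (Δ - 2) * ‖v - w‖ ^ (-(2 * Δ))) =
      ENNReal.ofReal ((Real.Gamma (2 - Δ) * Real.Gamma Δ)⁻¹) *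
        ∫⁻ s in Ioi (0:ℝ), ∫⁻ u in Ioi (0:ℝ),
          ENNReal.ofReal (s * u ^ (Δ - 1) * rexp (-s) *
            (rexp (-s * ‖w‖ ^ 2) * rexp (-(s * u) * ‖v - w‖ ^ 2))) := by
  have hb : 0 < 1 + ‖w‖ ^ 2 := by positivity
  have hc : 0 < ‖v - w‖ := norm_sub_pos_iff.2 hw.symm
  have hΓ : 0 < Real.Gamma Δ := Real.Gamma_pos_of_pos hΔ0
  have hΓ' : 0 < Real.Gamma (2 - Δ) := Real.Gamma_pos_of_pos (by linarith)
  -- the first factor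
  have h1 : ENNReal.ofReal ((1 + ‖w‖ ^ 2) ^ (Δ - 2)) =
      ENNReal.ofReal (Real.Gamma (2 - Δ))⁻¹ * ∫⁻ s in Ioi (0:ℝ),
        ENNReal.ofReal (s ^ ((2 - Δ) - 1) * rexp (-((1 + ‖w‖ ^ 2) * s))) := by
    rw [rieszBalayage_lintegral_rpow_mul_exp (by linarith) hb,
      ← ENNReal.ofReal_mul (by positivity), one_div, Real.inv_rpow hb.le,
      ← Real.rpow_neg hb.le, neg_sub]
    congr 1
    field_simp
  -- the second factor, for every `s > 0`
  have h2 : ∀ s ∈ Ioi (0:ℝ), ENNReal.ofReal (‖v - w‖ ^ (-(2 * Δ))) =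
      ENNReal.ofReal ((Real.Gamma Δ)⁻¹ * s ^ Δ) *
        ∫⁻ u in Ioi (0:ℝ),
          ENNReal.ofReal (u ^ (Δ - 1) * rexp (-((s * ‖v - w‖ ^ 2) * u))) := by
    intro s hs
    have hs : (0:ℝ) < s := hs
    rw [rieszBalayage_lintegral_rpow_mul_exp hΔ0 (by positivity),
      ← ENNReal.ofReal_mul (by positivity)]
    congr 1
    have e : (‖v - w‖ ^ 2) ^ Δ = ‖v - w‖ ^ (2 * Δ) := by
      rw [← Real.rpow_natCast, ← Real.rpow_mul hc.le]; norm_num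
    rw [one_div, Real.inv_rpow (by positivity), Real.mul_rpow hs.le (by positivity), e,
      Real.rpow_neg hc.le]
    have h₁ : 0 < s ^ Δ := by positivity
    have h₂ : 0 < ‖v - w‖ ^ (2 * Δ) := by positivity
    field_simp
  calc ENNReal.ofReal ((1 + ‖w‖ ^ 2) ^ (Δ - 2) * ‖v - w‖ ^ (-(2 * Δ)))
      = ENNReal.ofReal ((1 + ‖w‖ ^ 2) ^ (Δ - 2)) *
          ENNReal.ofReal (‖v - w‖ ^ (-(2 * Δ))) := ENNReal.ofReal_mul (by positivity)
    _ = ENNReal.ofReal (Real.Gamma (2 - Δ))⁻¹ * ∫⁻ s in Ioi (0:ℝ),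
          ENNReal.ofReal (s ^ ((2 - Δ) - 1) * rexp (-((1 + ‖w‖ ^ 2) * s))) *
            ENNReal.ofReal (‖v - w‖ ^ (-(2 * Δ))) := by
        rw [h1, mul_assoc, lintegral_mul_const' _ _ ENNReal.ofReal_ne_top]
    _ = ENNReal.ofReal (Real.Gamma (2 - Δ))⁻¹ * ∫⁻ s in Ioi (0:ℝ),
          ENNReal.ofReal (Real.Gamma Δ)⁻¹ * ∫⁻ u in Ioi (0:ℝ),
            ENNReal.ofReal (s * u ^ (Δ - 1) * rexp (-s) *
              (rexp (-s * ‖w‖ ^ 2) * rexp (-(s * u) * ‖v - w‖ ^ 2))) := by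
        congr 1
        refine setLIntegral_congr_fun measurableSet_Ioi (fun s hs => ?_)
        have hs' : (0:ℝ) < s := hs
        rw [h2 s hs, ← mul_assoc, ← ENNReal.ofReal_mul (by positivity),
          ← lintegral_const_mul' _ _ ENNReal.ofReal_ne_top,
          ← lintegral_const_mul' _ _ ENNReal.ofReal_ne_top]
        refine setLIntegral_congr_fun measurableSet_Ioi (fun u hu => ?_)
        have hu' : (0:ℝ) < u := hu
        rw [← ENNReal.ofReal_mul (by positivity), ← ENNReal.ofReal_mul (by positivity)]
        congr 1
        have hsΔ : s ^ ((2 - Δ) - 1) * s ^ Δ = s := by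
          rw [← Real.rpow_add hs', show 2 - Δ - 1 + Δ = 1 by ring, Real.rpow_one]
        have hA : rexp (-((1 + ‖w‖ ^ 2) * s)) = rexp (-s) * rexp (-s * ‖w‖ ^ 2) := by
          rw [← Real.exp_add]; congr 1; ring
        have hB : rexp (-((s * ‖v - w‖ ^ 2) * u)) = rexp (-(s * u) * ‖v - w‖ ^ 2) := by
          congr 1; ring
        rw [hA, hB]
        calc s ^ ((2 - Δ) - 1) * (rexp (-s) * rexp (-s * ‖w‖ ^ 2)) *
              ((Real.Gamma Δ)⁻¹ * s ^ Δ) * (u ^ (Δ - 1) * rexp (-(s * u) * ‖v - w‖ ^ 2))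
            = (Real.Gamma Δ)⁻¹ * ((s ^ ((2 - Δ) - 1) * s ^ Δ) * u ^ (Δ - 1) * rexp (-s) *
                (rexp (-s * ‖w‖ ^ 2) * rexp (-(s * u) * ‖v - w‖ ^ 2))) := by ring
          _ = _ := by rw [hsΔ]
    _ = _ := by
        rw [lintegral_const_mul' _ _ ENNReal.ofReal_ne_top, ← mul_assoc, ← ENNReal.ofReal_mul
          (by positivity), mul_inv]

/-- The balayage identity as a lower Lebesgue integral:
`∫ (1+|w|²)^{Δ-2} |v-w|^{-2Δ} dw = (π/(1-Δ)) (1+|v|²)^{-Δ}` for `1/2 ≤ Δ < 1`.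
[cite: Landkof1972, Chapter IV §5] -/
theorem rieszBalayage_lintegral {Δ : ℝ} (hΔ : 1 / 2 ≤ Δ) (hΔ1 : Δ < 1)
    (v : EuclideanSpace ℝ (Fin 2)) :
    ∫⁻ w, ENNReal.ofReal ((1 + ‖w‖ ^ 2) ^ (Δ - 2) * ‖v - w‖ ^ (-(2 * Δ))) =
      ENNReal.ofReal (π / (1 - Δ) * (1 + ‖v‖ ^ 2) ^ (-Δ)) := by
  have hΔ0 : 0 < Δ := by linarith
  have hΓ : 0 < Real.Gamma Δ := Real.Gamma_pos_of_pos hΔ0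
  have hΓ' : 0 < Real.Gamma (1 - Δ) := Real.Gamma_pos_of_pos (by linarith)
  have hΓ2 : 0 < Real.Gamma (2 - Δ) := Real.Gamma_pos_of_pos (by linarith)
  -- (i) subordination, almost everywhere (off the null set `{v}`)
  have h_ae : ∀ᵐ w ∂(volume : Measure (EuclideanSpace ℝ (Fin 2))),
      ENNReal.ofReal ((1 + ‖w‖ ^ 2) ^ (Δ - 2) * ‖v - w‖ ^ (-(2 * Δ))) =
        ENNReal.ofReal ((Real.Gamma (2 - Δ) * Real.Gamma Δ)⁻¹) *
          ∫⁻ s in Ioi (0:ℝ), ∫⁻ u in Ioi (0:ℝ),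
            ENNReal.ofReal (s * u ^ (Δ - 1) * rexp (-s) *
              (rexp (-s * ‖w‖ ^ 2) * rexp (-(s * u) * ‖v - w‖ ^ 2))) := by
    have h0 := measure_eq_zero_iff_ae_notMem.1
      (measure_singleton (μ := (volume : Measure (EuclideanSpace ℝ (Fin 2)))) v)
    filter_upwards [h0] with w hw
    exact rieszBalayage_kernel_eq_lintegral hΔ0 (by linarith) v w (by simpa using hw)
  rw [lintegral_congr_ae h_ae, lintegral_const_mul' _ _ ENNReal.ofReal_ne_top]
  -- (ii) Tonelli: the `w`-integral innermost
  have hsw1 :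
      ∫⁻ w : EuclideanSpace ℝ (Fin 2), ∫⁻ s in Ioi (0:ℝ), ∫⁻ u in Ioi (0:ℝ),
      ENNReal.ofReal (s * u ^ (Δ - 1) * rexp (-s) *
        (rexp (-s * ‖w‖ ^ 2) * rexp (-(s * u) * ‖v - w‖ ^ 2))) =
      ∫⁻ s in Ioi (0:ℝ), ∫⁻ w : EuclideanSpace ℝ (Fin 2), ∫⁻ u in Ioi (0:ℝ),
      ENNReal.ofReal (s * u ^ (Δ - 1) * rexp (-s) *
        (rexp (-s * ‖w‖ ^ 2) * rexp (-(s * u) * ‖v - w‖ ^ 2))) :=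
    lintegral_lintegral_swap (by fun_prop)
  have hsw2 : ∀ s : ℝ, ∫⁻ w : EuclideanSpace ℝ (Fin 2), ∫⁻ u in Ioi (0:ℝ),
      ENNReal.ofReal (s * u ^ (Δ - 1) * rexp (-s) *
        (rexp (-s * ‖w‖ ^ 2) * rexp (-(s * u) * ‖v - w‖ ^ 2))) =
      ∫⁻ u in Ioi (0:ℝ), ∫⁻ w : EuclideanSpace ℝ (Fin 2),
      ENNReal.ofReal (s * u ^ (Δ - 1) * rexp (-s) *
        (rexp (-s * ‖w‖ ^ 2) * rexp (-(s * u) * ‖v - w‖ ^ 2))) :=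
    fun s => lintegral_lintegral_swap (by fun_prop)
  rw [hsw1]
  simp_rw [hsw2]
  -- (iii) the Gaussian `w`-integral
  have h3 : ∀ s ∈ Ioi (0:ℝ), ∀ u ∈ Ioi (0:ℝ), ∫⁻ w : EuclideanSpace ℝ (Fin 2),
      ENNReal.ofReal (s * u ^ (Δ - 1) * rexp (-s) *
        (rexp (-s * ‖w‖ ^ 2) * rexp (-(s * u) * ‖v - w‖ ^ 2))) =
      ENNReal.ofReal (π * u ^ (Δ - 1) / (1 + u) *
        rexp (-((1 + u * ‖v‖ ^ 2 / (1 + u)) * s))) := by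
    intro s hs u hu
    have hs : (0:ℝ) < s := hs
    have hu : (0:ℝ) < u := hu
    have h0 : 0 ≤ s * u ^ (Δ - 1) * rexp (-s) := by positivity
    simp_rw [ENNReal.ofReal_mul h0]
    rw [lintegral_const_mul' _ _ ENNReal.ofReal_ne_top,
      rieszBalayage_lintegral_gauss_conv hs (mul_pos hs hu) v, ← ENNReal.ofReal_mul h0]
    congr 1
    have hs' : s ≠ 0 := hs.ne'
    have hu1 : (1 + u) ≠ 0 := by positivity
    have e1 : s * (s * u) / (s + s * u) = s * u / (1 + u) := by field_simp
    have e2 : π / (s + s * u) = π / (1 + u) / s := by field_simp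
    have e3 : rexp (-((1 + u * ‖v‖ ^ 2 / (1 + u)) * s)) =
        rexp (-s) * rexp (-(s * u / (1 + u)) * ‖v‖ ^ 2) := by
      rw [← Real.exp_add]; congr 1; field_simp; ring
    rw [e1, e2, e3]; field_simp
  rw [setLIntegral_congr_fun measurableSet_Ioi fun s hs =>
    setLIntegral_congr_fun measurableSet_Ioi fun u hu => h3 s hs u hu]
  -- (iv) Tonelli again, and the `s`-integral
  rw [lintegral_lintegral_swap (by fun_prop)]
  have h4 : ∀ u ∈ Ioi (0:ℝ), ∫⁻ s in Ioi (0:ℝ),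
      ENNReal.ofReal (π * u ^ (Δ - 1) / (1 + u) * rexp (-((1 + u * ‖v‖ ^ 2 / (1 + u)) * s))) =
        ENNReal.ofReal π * ENNReal.ofReal (u ^ (Δ - 1) / (1 + (1 + ‖v‖ ^ 2) * u)) := by
    intro u hu
    have hu : (0:ℝ) < u := hu
    have h0 : 0 ≤ π * u ^ (Δ - 1) / (1 + u) := by positivity
    simp_rw [ENNReal.ofReal_mul h0]
    rw [lintegral_const_mul' _ _ ENNReal.ofReal_ne_top, rieszBalayage_lintegral_exp (by positivity),
      ← ENNReal.ofReal_mul h0, ← ENNReal.ofReal_mul pi_pos.le]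
    congr 1
    have hu1 : (1 + u) ≠ 0 := by positivity
    field_simp
    ring
  rw [setLIntegral_congr_fun measurableSet_Ioi h4, lintegral_const_mul' _ _ ENNReal.ofReal_ne_top,
    rieszBalayage_lintegral_beta hΔ0 hΔ1 (by positivity : (0:ℝ) < 1 + ‖v‖ ^ 2)]
  -- (v) the constant: `Γ(2-Δ) = (1-Δ) Γ(1-Δ)`
  rw [← ENNReal.ofReal_mul pi_pos.le, ← ENNReal.ofReal_mul (by positivity),
    show (2 - Δ) = (1 - Δ) + 1 by ring, Real.Gamma_add_one (by linarith)]
  congr 1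
  have h1Δ : (1 - Δ) ≠ 0 := by linarith
  field_simp

/-- The mass identity as a lower Lebesgue integral:
`∫ (1+|v|²)^{Δ-2} (1+|v|²)^{-Δ} dv = ∫ (1+|v|²)^{-2} dv = π`. [folklore] -/
theorem rieszBalayage_lintegral_mass {Δ : ℝ} :
    ∫⁻ v : EuclideanSpace ℝ (Fin 2),
        ENNReal.ofReal ((1 + ‖v‖ ^ 2) ^ (Δ - 2) * (1 + ‖v‖ ^ 2) ^ (-Δ)) =
      ENNReal.ofReal π := by
  have h1 : ∀ v : EuclideanSpace ℝ (Fin 2),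
      ENNReal.ofReal ((1 + ‖v‖ ^ 2) ^ (Δ - 2) * (1 + ‖v‖ ^ 2) ^ (-Δ)) =
        ∫⁻ s in Ioi (0:ℝ), ENNReal.ofReal (s * rexp (-s) * rexp (-s * ‖v‖ ^ 2)) := by
    intro v
    have hb : 0 < 1 + ‖v‖ ^ 2 := by positivity
    rw [← Real.rpow_add hb, show Δ - 2 + -Δ = -2 by ring]
    have key := rieszBalayage_lintegral_rpow_mul_exp two_pos hb
    have hΓ2 : Real.Gamma 2 = 1 := by
      rw [show (2:ℝ) = 1 + 1 by norm_num, Real.Gamma_add_one one_ne_zero, Real.Gamma_one, mul_one]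
    rw [hΓ2, mul_one, one_div, Real.inv_rpow hb.le, ← Real.rpow_neg hb.le] at key
    rw [← key]
    refine setLIntegral_congr_fun measurableSet_Ioi (fun s _ => ?_)
    congr 1
    rw [show (2:ℝ) - 1 = 1 by norm_num, Real.rpow_one, mul_assoc, ← Real.exp_add]
    congr 2; ring
  simp_rw [h1]
  rw [lintegral_lintegral_swap (by fun_prop)]
  have h2 : ∀ s ∈ Ioi (0:ℝ), ∫⁻ v : EuclideanSpace ℝ (Fin 2),
      ENNReal.ofReal (s * rexp (-s) * rexp (-s * ‖v‖ ^ 2)) =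
        ENNReal.ofReal π * ENNReal.ofReal (rexp (-(1 * s))) := by
    intro s hs
    have hs : (0:ℝ) < s := hs
    have h0 : 0 ≤ s * rexp (-s) := by positivity
    simp_rw [ENNReal.ofReal_mul h0]
    rw [lintegral_const_mul' _ _ ENNReal.ofReal_ne_top, rieszBalayage_lintegral_gauss hs,
      ← ENNReal.ofReal_mul h0, ← ENNReal.ofReal_mul pi_pos.le]
    congr 1
    field_simp
  rw [setLIntegral_congr_fun measurableSet_Ioi h2, lintegral_const_mul' _ _ ENNReal.ofReal_ne_top,
    rieszBalayage_lintegral_exp one_pos]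
  simp

/-- **Stub C2** (`stub_rieszBalayage`): M. Riesz' balayage identity onto a plane for the kernel
`|v - w|^{-2Δ}` on `ℝ²`, `∫ (1+|w|²)^{Δ-2} |v-w|^{-2Δ} dw = (π/(1-Δ)) (1+|v|²)^{-Δ}`,
together with its mass `∫ (1+|v|²)^{Δ-2} (1+|v|²)^{-Δ} dv = π`, for `1/2 ≤ Δ < 1` (Bochner
integrals; the integrands are non-negative and the values finite, so they are the lower
Lebesgue integrals computed above). [cite: Landkof1972, Chapter IV §5] -/
theorem stub_rieszBalayage :
    ∀ Δ : ℝ, 1 / 2 ≤ Δ → Δ < 1 →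
      (∀ v : EuclideanSpace ℝ (Fin 2), ∫ w : EuclideanSpace ℝ (Fin 2),
          (1 + ‖w‖ ^ 2) ^ (Δ - 2) * ‖v - w‖ ^ (-(2 * Δ)) =
            Real.pi / (1 - Δ) * (1 + ‖v‖ ^ 2) ^ (-Δ)) ∧
      ∫ v : EuclideanSpace ℝ (Fin 2), (1 + ‖v‖ ^ 2) ^ (Δ - 2) * (1 + ‖v‖ ^ 2) ^ (-Δ) = Real.pi := by
  intro Δ hΔ hΔ1
  have h1Δ : 0 < 1 - Δ := by linarith
  refine ⟨fun v => ?_, ?_⟩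
  · rw [integral_eq_lintegral_of_nonneg_ae (Eventually.of_forall fun w => by positivity)
      (by fun_prop), rieszBalayage_lintegral hΔ hΔ1 v, ENNReal.toReal_ofReal (by positivity)]
  · rw [integral_eq_lintegral_of_nonneg_ae (Eventually.of_forall fun w => by positivity)
      (by fun_prop), rieszBalayage_lintegral_mass, ENNReal.toReal_ofReal pi_pos.le]

end Summit.CriticalPhenomena.Ising3DConformalLimit.Cruxes.GaussianLimitNotScreened.SingleLayerLinearRegression
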